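/-
Copyright (c) 2026 the pub-hodgecm-mathlib formalisation cell (harness21).  Prover seat hodgecm-mathlib-A-p03 (g24); LEAD F0P3a-plan (g9) WORD T8-81 «LAYER B_H»,
2026-09-01.
-/
import Literature.NumberTheory.Rogawski1990.UnitOrbitalIntegralInertPiecewise
import HarnessLib

/-!
# Prop. 10, `T_H` clause: the table at `N₊ = min(1+N₂, 1+2N)` equals the printed table at `1+N₂` (for `ν ≤ N`)

Topic `NumberTheory/Rogawski1990` (road «D-N7-inert», LAYER B_H glue); namespace `Literature.NumberTheory.Rogawski1990.Flicker1998`.  THEOREMS ONLY; kernel lane.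

In the ramified (`T_H`) case Flicker (p. 87) finds `N₊ = ord(2α″) = min(1 + N₂, 1 + 2N)` («since `α′ = ασε⁻¹ − 1 = −√D D₂π^{1+N₂} + B²π^{1+2N}∕2 + …`»), while the
printed table of Prop. 10 (p. 85) reads `min([ν∕2], [(1+N₂)∕2])` and `ν = 1 + N₂ < 2m ≤ 2 + 2N₂`.  Since `ν = N − j ≤ N < 1 + 2N`, the two tables coincide:
**`iTen_min_eq_iTen_of_le`** — so ★ `natCard_cosets_eq_iTen_gen_of_package` (output `iTen q ν N₊ m`) feeds B-p14's ★ `sum_pow_mul_innerSumTen_eq_phiTH`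
(input `innerSumTen q ν (1+N₂)`) after this rewrite.
HONEST LABEL: arithmetic on the `if`-chain of ★ `iTen`; HC_CM is proved only modulo the printed citations until rung 0 closes.

## References
* [Flicker1998UnitaryFL] Y. Z. Flicker, *Elementary proof of the fundamental lemma for a unitary group*, Canad. J. Math. 50 (1998), 74–98: Prop. 10 p. 85, proof p. 87.
-/

set_option autoImplicit false

namespace Literature.NumberTheory.Rogawski1990

namespace Flicker1998

/-- **`iTen q ν (min (1+N₂) (1+2N)) m = iTen q ν (1+N₂) m` for `ν ≤ N`**: the `T_H`-clause exponent `N₊ = min(1+N₂, 1+2N)` (p. 87) gives the printed table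
(p. 85) — the branch conditions only see `min([ν∕2],[N₊∕2])` and `ν = N₊`, and `ν ≤ N < 1 + 2N`. [cite: Flicker1998UnitaryFL, Prop. 10 p. 85, p. 87] -/
theorem iTen_min_eq_iTen_of_le (q : ℕ) {ν N N₂ : ℕ} (hν : ν ≤ N) (m : ℕ) :
    iTen q ν (min (1 + N₂) (1 + 2 * N)) m = iTen q ν (1 + N₂) m := by
  have h1 : min (ν / 2) (min (1 + N₂) (1 + 2 * N) / 2) = min (ν / 2) ((1 + N₂) / 2) := by omega
  have h2 : (ν = min (1 + N₂) (1 + 2 * N)) ↔ (ν = 1 + N₂) := by omega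
  simp only [iTen, h1, h2]

/-- The same for an exponent merely BOUNDED by `1 + 2N` from the `N₂` side: if `N₊ = 1 + N₂` or (`N₊ = 1 + 2N < 1 + N₂`), the table is the printed one.
[cite: Flicker1998UnitaryFL, Prop. 10 p. 85, p. 87] -/
theorem iTen_eq_iTen_of_le_of_or (q : ℕ) {ν N N₂ Np : ℕ} (hν : ν ≤ N) (h : Np = 1 + N₂ ∨ (Np = 1 + 2 * N ∧ 2 * N < N₂)) (m : ℕ) :
    iTen q ν Np m = iTen q ν (1 + N₂) m := by
  rcases h with rfl | ⟨rfl, hlt⟩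
  · rfl
  · rw [← iTen_min_eq_iTen_of_le q hν (N₂ := N₂) m, min_eq_right (by omega)]

end Flicker1998

end Literature.NumberTheory.Rogawski1990
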